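import Summits.CriticalPhenomena.PercolationContinuityZ3.Theorems.PercNearOneGluingNoHeavyQuantSubfloorHubGeneral
import HarnessLib

/-!
# QUANT lane R8, T-DEC: EVERY FOREST OF GLUED CHILDREN `R[q₁](R²[g₁]) ⊔ … ⊔ R[q_k](R²[g_k])` (`mᵢ = qᵢ(1+2gᵢ) ≥ 2`), EVERY WIDTH `k`, IS SDEC AT
# EVERY FLOOR `x ≤ min qᵢgᵢ` — ORACLE-FREE (census-1 gen 31; the k-general form of census-1 g30's `sdec_gluedChildren3`)

builds on p205010 (kernel theorem, internal audit signed; external expert review pending)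

Support file (`--supports stmt-CriticalPhenomena-4575`), QUANT lane seat prim-quant-census-1 (gen 31); memo
`run/shared/lean/prim/quant/prim-quant-census-1/g31/HUB-GENERAL-G31.md`.  Theorems only (no definitions), standard axioms, no sorries.  Uses the hub of
every width `sdec_cHub` / `cHub_laws` / `farPieces_sum_bounds` (census-1 g31 `…QuantSubfloorHubGeneral`, `…QuantSubfloorHubLaws`), census-1 g30's
`gate_gluedChild_eq_mix` / `gluedChild_params` / `gluedChild_laws` / `sdec_gluedChild` / `sdec_farPieceBlob` / `farPieceBlob_eq_lconv` / `sdec_blob3_step` /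
`sdec_mix_laws` / `cp_laws` / `blob3_laws` / `lconv_laws`, `lconv_mix_right` (census-1 g28), `lconv_assoc` / `lconv_comm` / `lconv_delta_left/right`,
`flaw_facts` (typer, `…QuantForestData`).

THE FAMILY.  A glued child `R[q](R²[g])` is the sibling `gate C(g) q`, `C(g) = {1: 1−g, 3: g}` (a sure relay over a glued pair at gate `g`); for
`m = q(1+2g) > 2` and floors `(m−1)/2 < x ≤ qg` it is heavy-unfloored — neither tame (`sdec_flaw_of_tame`) nor hull+high (`sdec_flaw_of_hullHigh`) —
the named residue of the node `SiblingStep` (RATE-PLAN §57.5/§58.4).  Widths 2 and 3: census-1 g30 (`sdec_gluedChildren2`, `sdec_gluedChildren3`).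

THE PROOF = the k-FOLD PIECE EXPANSION as ONE induction on the sibling list with a prefix hub.  `gate C(g) q = α·blob₃(m/3) + (1−α)·C(γ)` exactly
(`gate_gluedChild_eq_mix`, `γ = (m−1)/2`), so with `G = cHub P ∗ flaw L` (`P` a list of far-giant piece gates already split off):
`cHub P ∗ flaw (s :: L) = α·(G ∗ blob₃(m/3)) + (1−α)·(cHub (γ :: P) ∗ flaw L)` (`hubForest_piece`: re-association by `lconv_assoc` / `lconv_comm`).
* **`gluedChildren_inv`** — for every `L` (glued children at floor `x`) and every prefix `P` (`1/2 ≤ γ < 1`, `3x ≤ 1 + 2γ`): (1) `G` is a probability law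
  on `{0..3|P| + ftop L}` with mean `Σ_P (1+2γ) + fmean L`; (2) `G` is SDEC at `x` unless `|P| = 1 ∧ L = []` (a lone far-giant piece — the only
  non-SDEC term); (3) `G ∗ blob₃(θ)` is SDEC for every `2/3 ≤ θ < 1`, `x ≤ θ`.  Base `L = []`: (2) is `sdec_cHub` (the hub of EVERY width, g31) /
  `δ₀`; (3) is `sdec_farPieceBlob` at `|P| = 1`, else (2) + `sdec_blob3_step`.  Step: the two terms are (3) at `(P, L)` and (2) at `(γ :: P, L)`
  (condition `|P| ≥ 1 ∨ L ≠ []`; the corner `P = [] ∧ L = []` is `sdec_gluedChild`), joined by `sdec_mix_laws`; (3) by `sdec_blob3_step`.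
* **`sdec_gluedChildren_forest`** — `∀ L`, every sibling a glued child with `mᵢ ≥ 2` and `x ≤ qᵢgᵢ`, `0 < x` ⟹ **`SDEC x (ftop L) (flaw L)`**
  (clause (2) at `P = []`).  `gluedChildren_ftop_fmean`: `ftop L = 3k`, `x·ftop L ≤ fmean L`.

HONEST STATUS.  An unconditional SDEC family of every width inside the heavy-unfloored residue; `SiblingStep` (all tree-OK forests), `GluedDominated`,
`SDECConvClosed`, `FarTreeRow` OPEN; RATE class (log\*) / honest sentence of `run/shared/lean/prim/quant/README.md` unchanged.  [this work].  Nothing here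
is cited as a published result.  The gluing rows served [cite: KozmaNitzan2024, Conjecture 3 (p. 15)]; product measure [cite: Grimmett1999, §1.3 p. 10].
-/

noncomputable section

open scoped BigOperators

namespace Summit.CriticalPhenomena.PercolationContinuityZ3.Theorems
namespace Quant
namespace LawDec

open Finset

/-- the point mass `δ_K` -/
local notation3 "δ[" K "]" => (fun k : ℕ => if k = (K : ℕ) then (1 : ℝ) else 0)

/-- the FAR-GIANT PIECE `C(γ) = {1, 3; γ}` -/
local notation3 "CP[" a "]" => (fun h : ℕ => (1 - (a : ℝ)) * (if h = 1 then (1 : ℝ) else 0) + (a : ℝ) * (if h = 3 then (1 : ℝ) else 0))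

/-- re-association of the expansion term: `(cHub P ∗ flaw L) ∗ C(γ) = cHub (γ :: P) ∗ flaw L`. [this work] -/
theorem hubForest_piece (P : List ℝ) (L : List Sib) (γ : ℝ) :
    lconv (3 * P.length + ftop L) 3 (lconv (3 * P.length) (ftop L) (cHub P) (flaw L)) CP[γ]
      = lconv (3 * P.length + 3) (ftop L) (cHub (γ :: P)) (flaw L) :=
  calc lconv (3 * P.length + ftop L) 3 (lconv (3 * P.length) (ftop L) (cHub P) (flaw L)) CP[γ]
      = lconv (3 * P.length) (ftop L + 3) (cHub P) (lconv (ftop L) 3 (flaw L) CP[γ]) := (lconv_assoc _ _ _ _ _ _).symm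
    _ = lconv (3 * P.length) (3 + ftop L) (cHub P) (lconv 3 (ftop L) CP[γ] (flaw L)) := by
        rw [lconv_comm (ftop L) 3 (flaw L), Nat.add_comm (ftop L) 3]
    _ = lconv (3 * P.length + 3) (ftop L) (lconv (3 * P.length) 3 (cHub P) CP[γ]) (flaw L) := lconv_assoc _ _ _ _ _ _
    _ = lconv (3 * P.length + 3) (ftop L) (cHub (γ :: P)) (flaw L) := rfl

/-- `ftop` and `fmean` of a list of glued children: `ftop = 3·length`, `x·ftop ≤ fmean`. [this work] -/
theorem gluedChildren_ftop_fmean {x : ℝ} : ∀ L : List Sib,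
    (∀ s ∈ L, s.M = 3 ∧ 0 < s.q ∧ s.q < 1 ∧ ∃ g : ℝ, 0 < g ∧ g < 1 ∧ s.ρ = CP[g] ∧ 2 ≤ s.q * (1 + 2 * g) ∧ x ≤ s.q * g) →
    ftop L = 3 * L.length ∧ x * (ftop L : ℝ) ≤ fmean L
  | [], _ => by simp [ftop, fmean]
  | s :: L, hL => by
    obtain ⟨hM, hq0, _, g, hg0, hg1, hρ, _, hxg⟩ := hL s (by simp)
    obtain ⟨ih1, ih2⟩ := gluedChildren_ftop_fmean L (fun s' h' => hL s' (List.mem_cons_of_mem s h'))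
    have hmean : s.mean = 1 + 2 * g := by
      unfold Sib.mean; rw [hM, hρ]; exact (cp_laws hg0.le hg1.le).2.2.2
    simp only [ftop, fmean, List.length_cons, hM, hmean]
    refine ⟨by rw [ih1]; ring, ?_⟩
    push_cast
    nlinarith [ih2, hxg, mul_nonneg hq0.le (show (0 : ℝ) ≤ 1 - g by linarith)]

/-- **THE INVARIANT** of the k-fold piece expansion.  For a list `L` of glued children and a prefix `P` of far-giant piece gates, let
`G = cHub P ∗ flaw L`.  Then: `G` is a probability law on `{0..3|P| + ftop L}` with mean `Σ_P (1+2γ) + fmean L`; `G` is SDEC at `x` unless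
`|P| = 1` and `L = []` (a lone far-giant piece); and `G ∗ blob₃(θ)` is SDEC for every big heavy blob `2/3 ≤ θ < 1`, `x ≤ θ`. [this work] -/
theorem gluedChildren_inv {x : ℝ} (hx0 : 0 < x) (hx1 : x < 1) : ∀ L : List Sib,
    (∀ s ∈ L, s.M = 3 ∧ 0 < s.q ∧ s.q < 1 ∧ ∃ g : ℝ, 0 < g ∧ g < 1 ∧ s.ρ = CP[g] ∧ 2 ≤ s.q * (1 + 2 * g) ∧ x ≤ s.q * g) →
    ∀ P : List ℝ, (∀ γ ∈ P, 1 / 2 ≤ γ ∧ γ < 1 ∧ 3 * x ≤ 1 + 2 * γ) →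
      ((∀ h, 0 ≤ lconv (3 * P.length) (ftop L) (cHub P) (flaw L) h) ∧
        (∀ h, 3 * P.length + ftop L < h → lconv (3 * P.length) (ftop L) (cHub P) (flaw L) h = 0) ∧
        ∑ h ∈ Finset.range (3 * P.length + ftop L + 1), lconv (3 * P.length) (ftop L) (cHub P) (flaw L) h = 1 ∧
        ∑ h ∈ Finset.range (3 * P.length + ftop L + 1), (h : ℝ) * lconv (3 * P.length) (ftop L) (cHub P) (flaw L) h
          = (P.map (fun γ => 1 + 2 * γ)).sum + fmean L) ∧
      ((P.length ≠ 1 ∨ L ≠ []) → SDEC x (3 * P.length + ftop L) (lconv (3 * P.length) (ftop L) (cHub P) (flaw L))) ∧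
      (∀ θ : ℝ, 2 / 3 ≤ θ → θ < 1 → x ≤ θ →
        SDEC x (3 * P.length + ftop L + 3) (lconv (3 * P.length + ftop L) 3 (lconv (3 * P.length) (ftop L) (cHub P) (flaw L)) (gate δ[3] θ)))
  | [], _ => by
    intro P hP
    have hP01 : ∀ γ ∈ P, 0 ≤ γ ∧ γ ≤ 1 := fun γ h => ⟨by linarith [(hP γ h).1], (hP γ h).2.1.le⟩
    obtain ⟨a0, aM, a1, am⟩ := cHub_laws P hP01
    have eG : lconv (3 * P.length) (ftop []) (cHub P) (flaw []) = cHub P := by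
      funext h; exact lconv_delta_right _ _ _ aM h
    have eT : 3 * P.length + ftop [] = 3 * P.length := rfl
    rw [eG, eT]
    have hfm : fmean [] = 0 := rfl
    rw [hfm, add_zero]
    obtain ⟨hlo, _⟩ := farPieces_sum_bounds x P (fun γ h => ⟨(hP γ h).2.1, (hP γ h).2.2⟩)
    -- clause 2
    have c2 : (P.length ≠ 1 ∨ ([] : List Sib) ≠ []) → SDEC x (3 * P.length) (cHub P) := by
      intro hc
      have hne : P.length ≠ 1 := by
        rcases hc with h | h
        · exact h
        · exact absurd rfl h
      rcases Nat.lt_or_ge P.length 2 with hlt | hge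
      · have h0 : P.length = 0 := by omega
        rw [h0]
        intro q _ _ j' hj'
        omega
      · exact sdec_cHub hx0 P hge hP
    refine ⟨⟨a0, aM, a1, am⟩, c2, fun θ hθ hθ1 hxθ => ?_⟩
    by_cases h1 : P.length = 1
    · -- a lone far-giant piece beside a big heavy blob: `sdec_farPieceBlob`
      obtain ⟨γ, rfl⟩ : ∃ γ, P = [γ] := by
        rcases P with _ | ⟨γ, _ | ⟨γ', P'⟩⟩
        · simp at h1
        · exact ⟨γ, rfl⟩
        · simp at h1
      have hγ := hP γ (by simp)
      have cpv : ∀ h, 3 < h → CP[γ] h = 0 := fun h hh => by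
        simp only [show h ≠ 1 by omega, show h ≠ 3 by omega, if_false, mul_zero, add_zero]
      have e0 : cHub [γ] = CP[γ] := funext fun h => lconv_delta_left 0 3 _ cpv h
      show SDEC x 6 (lconv 3 3 (cHub [γ]) (gate δ[3] θ))
      rw [e0, farPieceBlob_eq_lconv]
      exact sdec_farPieceBlob hx0 hγ.1 hγ.2.1 hθ hθ1 hxθ hγ.2.2
    · exact (sdec_blob3_step hx0 hx1 hxθ hθ1.le a0 aM a1 am (by push_cast; linarith) (c2 (Or.inl h1))).2.2.2.2
  | s :: L, hL => by
    intro P hP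
    obtain ⟨hM, hq0, hq1, g, hg0, hg1, hρ, hm, hxg⟩ := hL s (by simp)
    have hL' : ∀ s' ∈ L, s'.M = 3 ∧ 0 < s'.q ∧ s'.q < 1 ∧ ∃ g : ℝ, 0 < g ∧ g < 1 ∧ s'.ρ = CP[g] ∧ 2 ≤ s'.q * (1 + 2 * g) ∧ x ≤ s'.q * g :=
      fun s' h' => hL s' (List.mem_cons_of_mem s h')
    obtain ⟨q, x₁, n, M, ρ⟩ := s
    simp only at hM hq0 hq1 hρ hm hxg
    subst hM
    subst hρ
    -- parameters of the glued child
    set m : ℝ := q * (1 + 2 * g) with hmdef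
    set α : ℝ := 3 * (1 - q) / (3 - m) with hα
    set γ : ℝ := (m - 1) / 2 with hγ
    obtain ⟨_, hα0, hα1, hm3, hm31, hγh, hγ1⟩ := gluedChild_params hq0 hq1 hg0 hg1 hm
    have hxγ : 3 * x ≤ 1 + 2 * γ := by rw [hγ]; nlinarith
    have hxm3 : x ≤ m / 3 := by nlinarith
    have hP01 : ∀ γ' ∈ P, 0 ≤ γ' ∧ γ' ≤ 1 := fun γ' h => ⟨by linarith [(hP γ' h).1], (hP γ' h).2.1.le⟩
    have hQ : ∀ γ' ∈ γ :: P, 1 / 2 ≤ γ' ∧ γ' < 1 ∧ 3 * x ≤ 1 + 2 * γ' := by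
      intro γ' h'
      rcases List.mem_cons.1 h' with rfl | h'
      · exact ⟨hγh, hγ1, hxγ⟩
      · exact hP γ' h'
    obtain ⟨⟨a0, aM, a1, am⟩, _, a3⟩ := gluedChildren_inv hx0 hx1 L hL' P hP
    obtain ⟨⟨b0, bM, b1, bm⟩, b2, _⟩ := gluedChildren_inv hx0 hx1 L hL' (γ :: P) hQ
    obtain ⟨_, aMP, _, _⟩ := cHub_laws P hP01
    obtain ⟨hft, hfm⟩ := gluedChildren_ftop_fmean L hL'
    obtain ⟨hlo, _⟩ := farPieces_sum_bounds x P (fun γ' h => ⟨(hP γ' h).2.1, (hP γ' h).2.2⟩)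
    -- names
    set N : ℕ := 3 * P.length + ftop L with hN
    set G : ℕ → ℝ := lconv (3 * P.length) (ftop L) (cHub P) (flaw L) with hG
    set X₁ : ℕ → ℝ := lconv N 3 G (gate δ[3] (m / 3)) with hX₁
    set X₂ : ℕ → ℝ := lconv (3 * P.length + 3) (ftop L) (cHub (γ :: P)) (flaw L) with hX₂
    have hsmean : Sib.mean ⟨q, x₁, n, 3, CP[g]⟩ = 1 + 2 * g := (cp_laws hg0.le hg1.le).2.2.2
    -- unfold the forest functionals of `s :: L`
    have eflaw : flaw (⟨q, x₁, n, 3, CP[g]⟩ :: L) = lconv (ftop L) 3 (flaw L) (gate CP[g] q) := rfl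
    have eftop : ftop (⟨q, x₁, n, 3, CP[g]⟩ :: L) = ftop L + 3 := rfl
    have efmean : fmean (⟨q, x₁, n, 3, CP[g]⟩ :: L) = fmean L + q * (1 + 2 * g) := by
      show fmean L + q * Sib.mean ⟨q, x₁, n, 3, CP[g]⟩ = _; rw [hsmean]
    rw [eflaw, eftop, efmean]
    simp only [List.length_cons] at b0 bM b1 bm b2
    rw [show 3 * (P.length + 1) = 3 * P.length + 3 by ring] at b0 bM b1 bm b2
    rw [show 3 * P.length + 3 + ftop L = N + 3 by rw [hN]; ring] at bM b1 bm b2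
    -- the mixture identity
    have hmix : ∀ h, lconv (3 * P.length) (ftop L + 3) (cHub P) (lconv (ftop L) 3 (flaw L) (gate CP[g] q)) h = α * X₁ h + (1 - α) * X₂ h := by
      intro h
      rw [lconv_assoc, lconv_mix_right _ _ _ _ _ _ α (fun k => gate_gluedChild_eq_mix hq1 hg0.le hg1 k) h, hX₁, hX₂,
        ← hubForest_piece P L γ]
    have eNt : 3 * P.length + (ftop L + 3) = N + 3 := by rw [hN]; ring
    rw [eNt]
    -- laws of `X₁`
    obtain ⟨bl0, _, bl1, blm⟩ := blob3_laws (show (0 : ℝ) ≤ m / 3 by linarith) hm31.le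
    obtain ⟨c0, cM, c1, cm⟩ := lconv_laws a0 a1 am bl0 bl1 blm
    have hX₁s : SDEC x (N + 3) X₁ := a3 (m / 3) hm3 hm31 hxm3
    -- the two component means agree
    have cm' : ∑ h ∈ Finset.range (N + 3 + 1), (h : ℝ) * X₁ h = (P.map (fun γ => 1 + 2 * γ)).sum + (fmean L + q * (1 + 2 * g)) := by
      rw [hX₁, cm]; rw [hmdef]; ring
    have bm' : ∑ h ∈ Finset.range (N + 3 + 1), (h : ℝ) * X₂ h = (P.map (fun γ => 1 + 2 * γ)).sum + (fmean L + q * (1 + 2 * g)) := by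
      rw [hX₂, bm]; simp only [List.map_cons, List.sum_cons]; rw [hγ, hmdef]; ring
    -- laws + SDEC of the new forest
    have main : ((∀ h, 0 ≤ lconv (3 * P.length) (ftop L + 3) (cHub P) (lconv (ftop L) 3 (flaw L) (gate CP[g] q)) h) ∧
        (∀ h, N + 3 < h → lconv (3 * P.length) (ftop L + 3) (cHub P) (lconv (ftop L) 3 (flaw L) (gate CP[g] q)) h = 0) ∧
        ∑ h ∈ Finset.range (N + 3 + 1), lconv (3 * P.length) (ftop L + 3) (cHub P) (lconv (ftop L) 3 (flaw L) (gate CP[g] q)) h = 1 ∧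
        ∑ h ∈ Finset.range (N + 3 + 1), (h : ℝ) * lconv (3 * P.length) (ftop L + 3) (cHub P) (lconv (ftop L) 3 (flaw L) (gate CP[g] q)) h
          = (P.map (fun γ => 1 + 2 * γ)).sum + (fmean L + q * (1 + 2 * g))) ∧
        SDEC x (N + 3) (lconv (3 * P.length) (ftop L + 3) (cHub P) (lconv (ftop L) 3 (flaw L) (gate CP[g] q))) := by
      by_cases hcorner : P = [] ∧ L = []
      · -- one glued child alone: `sdec_gluedChild`
        obtain ⟨rfl, rfl⟩ := hcorner
        obtain ⟨t0, tM, t1, tm⟩ := gluedChild_laws hq0.le hq1.le hg0.le hg1.le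
        have e1 : lconv (ftop []) 3 (flaw []) (gate CP[g] q) = gate CP[g] q := funext fun h => lconv_delta_left 0 3 _ tM h
        have e2 : lconv (3 * ([] : List ℝ).length) (ftop [] + 3) (cHub []) (gate CP[g] q) = gate CP[g] q :=
          funext fun h => lconv_delta_left 0 3 _ tM h
        have hN3 : N + 3 = 3 := by rw [hN]; rfl
        rw [e1, e2, hN3]
        refine ⟨⟨t0, tM, t1, by rw [tm]; simp [fmean]⟩, sdec_gluedChild hq0 hq1 hg0 hg1 hxg⟩
      · have hcond : (γ :: P).length ≠ 1 ∨ L ≠ [] := by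
          by_cases hPn : P = []
          · exact Or.inr (fun hLn => hcorner ⟨hPn, hLn⟩)
          · left; simp only [List.length_cons]; intro h; exact hPn (List.length_eq_zero_iff.1 (by omega))
        have hX₂s : SDEC x (N + 3) X₂ := b2 hcond
        obtain ⟨r0, rM, r1, rm, rS⟩ := sdec_mix_laws hα0 hα1 hmix c0 cM c1 cm' b0 bM b1 bm' hX₁s hX₂s
        exact ⟨⟨r0, rM, r1, rm⟩, rS⟩
    obtain ⟨⟨r0, rM, r1, rm⟩, rS⟩ := main
    refine ⟨⟨r0, rM, r1, rm⟩, fun _ => rS, fun θ hθ hθ1 hxθ => ?_⟩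
    -- clause 3: peel the blob
    have hta : x * ((N + 3 : ℕ) : ℝ) ≤ (P.map (fun γ => 1 + 2 * γ)).sum + (fmean L + q * (1 + 2 * g)) := by
      rw [hN]; push_cast
      have : x * ((ftop L : ℕ) : ℝ) ≤ fmean L := hfm
      nlinarith [hlo, this, hxg, mul_nonneg hq0.le (show (0 : ℝ) ≤ 1 - g by linarith)]
    exact (sdec_blob3_step hx0 hx1 hxθ hθ1.le r0 rM r1 rm hta rS).2.2.2.2

/-- **EVERY FOREST OF GLUED CHILDREN, EVERY WIDTH, IS SDEC AT THE TRUE FLOOR — ORACLE-FREE.**  For every list of siblings each of which is a glued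
child `R[qᵢ](R²[gᵢ])` (`ρᵢ = C(gᵢ) = {1: 1−gᵢ, 3: gᵢ}`, `0 < qᵢ, gᵢ < 1`, `mᵢ = qᵢ(1 + 2gᵢ) ≥ 2`) and every floor `0 < x ≤ min qᵢgᵢ`:
`SDEC x (ftop L) (flaw L)`.  (Widths 2, 3: census-1 g30 `sdec_gluedChildren2/3`.) [this work] -/
theorem sdec_gluedChildren_forest {x : ℝ} (hx0 : 0 < x) (L : List Sib)
    (hL : ∀ s ∈ L, s.M = 3 ∧ 0 < s.q ∧ s.q < 1 ∧ ∃ g : ℝ, 0 < g ∧ g < 1 ∧ s.ρ = CP[g] ∧ 2 ≤ s.q * (1 + 2 * g) ∧ x ≤ s.q * g) :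
    SDEC x (ftop L) (flaw L) := by
  by_cases hnil : L = []
  · subst hnil; intro q _ _ j' hj'; exact absurd hj' (Nat.not_lt_zero _)
  · obtain ⟨s, hs⟩ := List.exists_mem_of_ne_nil L hnil
    have hx1 : x < 1 := by
      obtain ⟨_, hq0, hq1, g, hg0, hg1, _, _, hxg⟩ := hL s hs
      nlinarith
    have hLaw : ∀ s ∈ L, s.LawOK := by
      intro s hs
      obtain ⟨hM, hq0, hq1, g, hg0, hg1, hρ, _, _⟩ := hL s hs
      obtain ⟨c0, cM, c1, _⟩ := cp_laws hg0.le hg1.le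
      refine ⟨hq0, hq1, ?_, ?_, ?_⟩
      · intro h; rw [hρ]; exact c0 h
      · intro h hh; rw [hρ]; exact cM h (by rw [hM] at hh; exact hh)
      · rw [hM, hρ]; exact c1
    obtain ⟨_, fM, _, _⟩ := flaw_facts L hLaw
    have h := (gluedChildren_inv hx0 hx1 L hL [] (fun γ h => by simp at h)).2.1 (Or.inl (by simp))
    have e : lconv (3 * ([] : List ℝ).length) (ftop L) (cHub []) (flaw L) = flaw L := funext fun k => lconv_delta_left _ _ _ fM k
    rw [e] at h
    simpa using h

end LawDec
end Quant
end Summit.CriticalPhenomena.PercolationContinuityZ3.Theorems
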